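import Summits.QuantumAdvantage.AdviceFreeQNC0.LDMATransfer
import Summits.QuantumAdvantage.AdviceFreeQNC0.ProductBound
import Summits.QuantumAdvantage.AdviceFreeQNC0.CrossTeamEmbedding
import Summits.QuantumAdvantage.AdviceFreeQNC0.AugmentedCodePatterns
import Summits.QuantumAdvantage.AdviceFreeQNC0.WindowDegree
import HarnessLib

/-!
# Cell qa-qnc0 (rung F-Q1, route RingFrame, crux α, line `product`): low-degree rows — proportional
# relative elimination and the bidegree family (planner qa-qnc0-p1 ROUND-9 §1, ask P8)

Planner qa-qnc0-p1 gen 10's third D-UNIFORM solved family of the LDMA line (HOME/qa-qnc0-p1/ROUND-9.md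
§1, `Sketch10.lean` §22.1), statements VERBATIM (`zeros`, `DistFailLeZeros`, `LowDegRowFar`,
`LowDegRowFarOfPLDAMS`, `LDMABidegWith`, `LDMABidegOfPLDAMS`, `RelElimProp`, `RelElimPropOfPLDAMS`) and PROVED:

* `distFailLeZeros : DistFailLeZeros` — `distFail D z ≤ zeros z` (the all-fail row is in `𝓕`).
* R1 `lowDegRowFar_of_pldamsBool : LowDegRowFarOfPLDAMS` — PLDAMS at profile `D'` ⟹ every row `z`
  of degree `≤ D' n` is `κ₀·#zeros(z)`-far from the fail family `𝓕_n(D)` (`max d D ≤ D' n`).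
  Proof: nearest fail pattern in class-`0` form `F = elimFail 0 a b`; for `t ∈ {0,1,2}` the row
  `q_t = z ⊕ elimFailBits 0 (a·) (b·) t` has degree `≤ max d D`, agrees with `[z ≠ F]` on class `t`,
  so `Σ_t #(supp q_t ∩ cls t) = dist(z, F)`; PLDAMS per class; and `{z = 0} ⊆ ⋃_t supp q_t` since
  every stakes pair fails against SOME class.
* R2 `ldmaBideg_of_pldamsBool : LDMABidegOfPLDAMS` — LDMA with the D-FREE constant `κ₀²` for maps of
  column degree `≤ D' L` AND row degree `≤ D' L'`:
  `Σ_{cls r} distFail ≥ κ₀ Σ_{cls r} zeros = κ₀ Σ_v #{u ∈ cls r : Γ u v = 0} ≥ κ₀² Σ_v #{u : Γ u v = 0}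
   = κ₀² Σ_u zeros ≥ κ₀² Σ_u distFail`.
* R1' `relElimProp_of_pldamsBool : RelElimPropOfPLDAMS` — inside the zero set of a low-degree row every
  eliminator fails on a `κ₀`-fraction (PLDAMS on the four level sets `{z = 0, a = α, b = β}` of degree
  `≤ d + 2D`, each failing on its named residue).

FENCE (ROUND-9 §1): with `pldamsBool_sqrt` a counterexample to `LDMAPolylog` needs rows of degree
`> c√L'`.  WHAT THIS IS NOT: nothing on `LDMAPolylog` for general rows, on α, or on the separation.
-/

noncomputable section

namespace Summit.QuantumAdvantage.AdviceFreeQNC0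

open Finset
open Literature.Computability.MetaComplexity Literature.Computability.MetaComplexity.Smolensky

/-! ### Vocabulary (verbatim from `Sketch10` §22.1) -/

/-- number of zeros of a Boolean row (= its Hamming distance to the all-fail pattern `𝟙 ∈ 𝓕`). -/
def zeros {n : ℕ} (z : (Fin n → Bool) → Bool) : ℕ :=
  (univ.filter fun v : Fin n → Bool => z v = false).card

/-- the trivial direction: `distFail D z ≤ zeros z` (`isElimFail_true`: the all-true row is a fail
pattern). -/
def DistFailLeZeros : Prop :=
  ∀ n D : ℕ, ∀ z : (Fin n → Bool) → Bool, distFail D z ≤ zeros z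

/-- **R1 — row lemma.** A row of degree `≤ D' n` is at distance `≥ κ₀·#zeros` from the fail family
`𝓕_n(D)` whenever `max d D ≤ D' n`. -/
def LowDegRowFar (κ₀ : ℝ) (D' : ℕ → ℕ) : Prop :=
  ∃ n₀ : ℕ, ∀ n : ℕ, n₀ ≤ n → ∀ d D : ℕ, max d D ≤ D' n →
    ∀ z : (Fin n → Bool) → Bool, HasDeg z d → κ₀ * (zeros z : ℝ) ≤ (distFail D z : ℝ)

/-- claim R1 as an implication. -/
def LowDegRowFarOfPLDAMS : Prop :=
  ∀ κ₀ : ℝ, ∀ D' : ℕ → ℕ, PLDAMSBool κ₀ D' → LowDegRowFar κ₀ D'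

/-- **R2 — the bidegree family: LDMA with the D-FREE constant `κ₀²`** for maps `Γ` of column degree
`≤ D' L` AND row degree `≤ D' L'` (`max d D ≤ D' L'`). -/
def LDMABidegWith (κ : ℝ) (D' : ℕ → ℕ) : Prop :=
  ∃ L₀ : ℕ, ∀ L L' : ℕ, L₀ ≤ L → L₀ ≤ L' → ∀ D d : ℕ, D ≤ D' L → max d D ≤ D' L' →
    ∀ Γ : (Fin L → Bool) → (Fin L' → Bool) → Bool,
      (∀ v, HasDeg (fun u => Γ u v) D) → (∀ u, HasDeg (Γ u) d) → ∀ r : ℕ,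
        κ * ((∑ u : Fin L → Bool, distFail D (Γ u) : ℕ) : ℝ) ≤
          ((∑ u ∈ cls L r, distFail D (Γ u) : ℕ) : ℝ)

/-- claim R2 as an implication. -/
def LDMABidegOfPLDAMS : Prop :=
  ∀ κ₀ : ℝ, ∀ D' : ℕ → ℕ, 0 ≤ κ₀ → PLDAMSBool κ₀ D' → LDMABidegWith (κ₀ ^ 2) D'

/-- **R1' — proportional relative elimination.** Inside the zero set of a low-degree row every
eliminator FAILS on a `κ₀`-fraction. -/
def RelElimProp (κ₀ : ℝ) (D' : ℕ → ℕ) : Prop :=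
  ∃ n₀ : ℕ, ∀ n : ℕ, n₀ ≤ n → ∀ d D : ℕ, d + 2 * D ≤ D' n →
    ∀ z a b : (Fin n → Bool) → Bool, HasDeg z d → HasDeg a D → HasDeg b D → ∀ c : ℕ,
      κ₀ * (zeros z : ℝ) ≤
        ((univ.filter fun v : Fin n → Bool => z v = false ∧ elimFail c a b v = true).card : ℝ)

/-- claim R1' as an implication. -/
def RelElimPropOfPLDAMS : Prop :=
  ∀ κ₀ : ℝ, ∀ D' : ℕ → ℕ, PLDAMSBool κ₀ D' → RelElimProp κ₀ D'

/-! ### The trivial direction -/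

/-- `distFail D z ≤ zeros z`. -/
theorem distFail_le_zeros {n : ℕ} (D : ℕ) (z : (Fin n → Bool) → Bool) : distFail D z ≤ zeros z := by
  refine (distFail_le z (isElimFail_true D)).trans (le_of_eq ?_)
  unfold hdist zeros
  congr 1
  exact Finset.filter_congr fun v _ => by cases z v <;> simp

/-- `DistFailLeZeros` holds. -/
theorem distFailLeZeros : DistFailLeZeros := fun _ D z => distFail_le_zeros D z

/-! ### R1: rows of low degree are proportionally far -/

variable {n : ℕ}

/-- The class-`t` test row `q_t = z ⊕ elimFailBits 0 (a·) (b·) t` has degree `≤ max d D`. -/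
theorem hasDeg_testRow {d D : ℕ} {z a b : (Fin n → Bool) → Bool} (hz : HasDeg z d) (ha : HasDeg a D)
    (hb : HasDeg b D) (t : ℕ) :
    HasDeg (fun v => xor (z v) (elimFailBits 0 (a v) (b v) t)) (max d D) := by
  have hE : HasDeg (fun v => elimFailBits 0 (a v) (b v) t) D := by
    by_cases h0 : (0 % 3 + 3 - t % 3) % 3 = 0
    · have e : (fun v => elimFailBits 0 (a v) (b v) t) = fun v => !b v := by
        funext v; unfold elimFailBits; rw [if_pos h0]
      rw [e]; exact hasDeg_not hb
    · by_cases h1 : (0 % 3 + 3 - t % 3) % 3 = 1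
      · have e : (fun v => elimFailBits 0 (a v) (b v) t) = fun v => !a v := by
          funext v; unfold elimFailBits; rw [if_neg h0, if_pos h1]
        rw [e]; exact hasDeg_not ha
      · have e : (fun v => elimFailBits 0 (a v) (b v) t) = fun v => !(xor (a v) (b v)) := by
          funext v; unfold elimFailBits; rw [if_neg h0, if_neg h1]; cases a v <;> cases b v <;> rfl
        rw [e]; exact hasDeg_not (hasDeg_xor ha hb)
  exact hasDeg_xor (hasDeg_of_le hz (le_max_left _ _)) (hasDeg_of_le hE (le_max_right _ _))

/-- On class `t` the test row `q_t` is the disagreement indicator `[z ≠ F]` of `F = elimFail 0 a b`. -/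
theorem testRow_eq_on_cls {z a b : (Fin n → Bool) → Bool} {t : ℕ} {v : Fin n → Bool}
    (hv : wt v % 3 = t % 3) :
    xor (z v) (elimFailBits 0 (a v) (b v) t) = decide (z v ≠ elimFail 0 a b v) := by
  unfold elimFail
  rw [elimFailBits_mod 0 (a v) (b v) (wt v), hv, ← elimFailBits_mod]
  cases z v <;> cases elimFailBits 0 (a v) (b v) t <;> rfl

/-- Every stakes pair fails against some class. -/
theorem exists_elimFailBits_true (α β : Bool) : ∃ t : Fin 3, elimFailBits 0 α β t.val = true := by
  revert α β; decide

/-- **R1 `LowDegRowFarOfPLDAMS`** (Sketch10 §22.1, verbatim). -/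
theorem lowDegRowFar_of_pldamsBool : LowDegRowFarOfPLDAMS := by
  intro κ₀ D' hP
  obtain ⟨n₀, hP⟩ := hP
  refine ⟨n₀, fun n hn d D hdD z hz => ?_⟩
  classical
  -- trivial if `κ₀ ≤ 0`
  by_cases hκ : κ₀ ≤ 0
  · exact le_trans (mul_nonpos_of_nonpos_of_nonneg hκ (by positivity)) (by positivity)
  push Not at hκ
  -- nearest fail pattern in class-`0` form
  obtain ⟨F, hF, hdF⟩ := exists_distFail_eq D z
  obtain ⟨a, b, ha, hb, hFab⟩ := isElimFail_class0 hF
  set q : Fin 3 → (Fin n → Bool) → Bool := fun t v => xor (z v) (elimFailBits 0 (a v) (b v) t.val)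
    with hq
  -- PLDAMS on each test row
  have hPq : ∀ t : Fin 3, κ₀ * ((univ.filter fun v : Fin n → Bool => q t v = true).card : ℝ) ≤
      ((univ.filter fun v : Fin n → Bool => q t v = true ∧ wt v % 3 = t.val % 3).card : ℝ) := by
    intro t
    exact hP n hn (q t) (hasDeg_of_le (hasDeg_testRow hz ha hb t.val) hdD) t.val
  -- the class-`t` part of `supp q_t` is the class-`t` part of the disagreement set
  have hcls : ∀ t : Fin 3, (univ.filter fun v : Fin n → Bool => q t v = true ∧ wt v % 3 = t.val % 3) =
      (univ.filter fun v : Fin n → Bool => z v ≠ F v).filter fun v => wt v % 3 = t.val % 3 := by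
    intro t
    rw [Finset.filter_filter]
    refine Finset.filter_congr fun v _ => ?_
    constructor
    · rintro ⟨h1, h2⟩
      have h1' : xor (z v) (elimFailBits 0 (a v) (b v) t.val) = true := h1
      rw [testRow_eq_on_cls h2, decide_eq_true_eq, ← hFab v] at h1'
      exact ⟨h1', h2⟩
    · rintro ⟨h1, h2⟩
      refine ⟨?_, h2⟩
      show xor (z v) (elimFailBits 0 (a v) (b v) t.val) = true
      rw [testRow_eq_on_cls h2, decide_eq_true_eq, ← hFab v]; exact h1
  -- summing the class parts gives the distance
  have hsum : ∑ t : Fin 3, ((univ.filter fun v : Fin n → Bool => z v ≠ F v).filter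
      fun v => wt v % 3 = t.val % 3).card = distFail D z := by
    rw [← hdF]
    unfold hdist
    rw [← Finset.card_biUnion]
    · congr 1
      ext v
      simp only [Finset.mem_biUnion, Finset.mem_univ, true_and, Finset.mem_filter]
      constructor
      · rintro ⟨t, hv, -⟩; exact hv
      · intro hv; exact ⟨⟨wt v % 3, Nat.mod_lt _ (by norm_num)⟩, hv, by simp⟩
    · intro s _ t _ hst
      rw [Function.onFun, Finset.disjoint_filter]
      intro v _ h1 h2
      apply hst
      apply Fin.ext
      have := h1.symm.trans h2
      simpa [Nat.mod_eq_of_lt s.isLt, Nat.mod_eq_of_lt t.isLt] using this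
  -- the zeros of `z` are covered by the supports of the `q_t`
  have hcover : (zeros z : ℝ) ≤ ∑ t : Fin 3, ((univ.filter fun v : Fin n → Bool => q t v = true).card : ℝ) := by
    have h : (univ.filter fun v : Fin n → Bool => z v = false) ⊆
        (univ : Finset (Fin 3)).biUnion fun t => univ.filter fun v : Fin n → Bool => q t v = true := by
      intro v hv
      rw [Finset.mem_filter] at hv
      obtain ⟨t, ht⟩ := exists_elimFailBits_true (a v) (b v)
      rw [Finset.mem_biUnion]
      refine ⟨t, Finset.mem_univ _, Finset.mem_filter.2 ⟨Finset.mem_univ _, ?_⟩⟩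
      show xor (z v) (elimFailBits 0 (a v) (b v) t.val) = true
      rw [hv.2, ht]; rfl
    have h2 := (Finset.card_le_card h).trans Finset.card_biUnion_le
    unfold zeros
    exact_mod_cast h2
  -- assemble
  calc κ₀ * (zeros z : ℝ) ≤ κ₀ * ∑ t : Fin 3, ((univ.filter fun v : Fin n → Bool => q t v = true).card : ℝ) :=
        mul_le_mul_of_nonneg_left hcover hκ.le
    _ = ∑ t : Fin 3, κ₀ * ((univ.filter fun v : Fin n → Bool => q t v = true).card : ℝ) := by
        rw [Finset.mul_sum]
    _ ≤ ∑ t : Fin 3, (((univ.filter fun v : Fin n → Bool => z v ≠ F v).filter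
          fun v => wt v % 3 = t.val % 3).card : ℝ) :=
        Finset.sum_le_sum fun t _ => by rw [← hcls t]; exact hPq t
    _ = (distFail D z : ℝ) := by rw [← hsum]; push_cast; rfl

/-! ### R2: the bidegree family -/

/-- Double counting: `Σ_{u ∈ S} zeros (Γ u) = Σ_v #{u ∈ S : Γ u v = 0}`. -/
theorem sum_zeros_eq {L L' : ℕ} (Γ : (Fin L → Bool) → (Fin L' → Bool) → Bool) (S : Finset (Fin L → Bool)) :
    ∑ u ∈ S, zeros (Γ u) = ∑ v : Fin L' → Bool, (S.filter fun u => Γ u v = false).card := by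
  unfold zeros
  simp_rw [Finset.card_filter]
  exact Finset.sum_comm

/-- **R2 `LDMABidegOfPLDAMS`** (Sketch10 §22.1, verbatim). -/
theorem ldmaBideg_of_pldamsBool : LDMABidegOfPLDAMS := by
  intro κ₀ D' hκ hP
  obtain ⟨n₁, hR1⟩ := lowDegRowFar_of_pldamsBool κ₀ D' hP
  obtain ⟨n₀, hP⟩ := hP
  refine ⟨max n₀ n₁, fun L L' hL hL' D d hD hdD Γ hcol hrow r => ?_⟩
  classical
  have hLn₀ : n₀ ≤ L := le_trans (le_max_left _ _) hL
  have hL'n₁ : n₁ ≤ L' := le_trans (le_max_right _ _) hL'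
  -- (1) class rows: `Σ_{cls r} distFail ≥ κ₀ Σ_{cls r} zeros`
  have h1 : κ₀ * ((∑ u ∈ cls L r, zeros (Γ u) : ℕ) : ℝ) ≤ ((∑ u ∈ cls L r, distFail D (Γ u) : ℕ) : ℝ) := by
    push_cast
    rw [Finset.mul_sum]
    exact Finset.sum_le_sum fun u _ => hR1 L' hL'n₁ d D hdD (Γ u) (hrow u)
  -- (2) columns: `Σ_{cls r} zeros = Σ_v #{u ∈ cls r : Γ u v = 0} ≥ κ₀ Σ_v #{u : Γ u v = 0} = κ₀ Σ_u zeros`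
  have h2 : κ₀ * ((∑ u : Fin L → Bool, zeros (Γ u) : ℕ) : ℝ) ≤ ((∑ u ∈ cls L r, zeros (Γ u) : ℕ) : ℝ) := by
    rw [show (∑ u : Fin L → Bool, zeros (Γ u)) = ∑ u ∈ univ, zeros (Γ u) from rfl, sum_zeros_eq Γ univ,
      sum_zeros_eq Γ (cls L r)]
    push_cast
    rw [Finset.mul_sum]
    refine Finset.sum_le_sum fun v _ => ?_
    have hdeg : HasDeg (fun u => !Γ u v) (D' L) := hasDeg_of_le (hasDeg_not (hcol v)) hD
    have h := hP L hLn₀ (fun u => !Γ u v) hdeg r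
    have e1 : (univ.filter fun u : Fin L → Bool => (!Γ u v) = true) = univ.filter fun u => Γ u v = false :=
      Finset.filter_congr fun u _ => by simp
    have e2 : (univ.filter fun u : Fin L → Bool => (!Γ u v) = true ∧ wt u % 3 = r % 3) =
        (cls L r).filter fun u => Γ u v = false := by
      unfold cls
      rw [Finset.filter_filter]
      exact Finset.filter_congr fun u _ => by simp [and_comm]
    rw [e1, e2] at h
    exact h
  -- assemble: `κ₀² Σ distFail ≤ κ₀² Σ zeros ≤ κ₀ Σ_{cls} zeros ≤ Σ_{cls} distFail`
  have h0 : ((∑ u : Fin L → Bool, distFail D (Γ u) : ℕ) : ℝ) ≤ ((∑ u : Fin L → Bool, zeros (Γ u) : ℕ) : ℝ) := by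
    exact_mod_cast Finset.sum_le_sum fun u _ => distFail_le_zeros D (Γ u)
  calc κ₀ ^ 2 * ((∑ u : Fin L → Bool, distFail D (Γ u) : ℕ) : ℝ)
      ≤ κ₀ ^ 2 * ((∑ u : Fin L → Bool, zeros (Γ u) : ℕ) : ℝ) := mul_le_mul_of_nonneg_left h0 (by positivity)
    _ = κ₀ * (κ₀ * ((∑ u : Fin L → Bool, zeros (Γ u) : ℕ) : ℝ)) := by ring
    _ ≤ κ₀ * ((∑ u ∈ cls L r, zeros (Γ u) : ℕ) : ℝ) := mul_le_mul_of_nonneg_left h2 hκ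
    _ ≤ ((∑ u ∈ cls L r, distFail D (Γ u) : ℕ) : ℝ) := h1

/-! ### R1': proportional relative elimination -/

/-- Every stakes pair fails against some residue, for every target class. -/
theorem exists_elimFailBits_true' (c : ℕ) (α β : Bool) : ∃ t : Fin 3, elimFailBits c α β t.val = true := by
  have key : ∀ c' : Fin 3, ∀ α β : Bool, ∃ t : Fin 3, elimFailBits c'.val α β t.val = true := by decide
  obtain ⟨t, ht⟩ := key ⟨c % 3, Nat.mod_lt _ (by norm_num)⟩ α β
  refine ⟨t, ?_⟩
  rw [elimFailBits_mod, Nat.mod_eq_of_lt t.isLt]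
  rw [elimFailBits_mod, Nat.mod_mod, Nat.mod_eq_of_lt t.isLt] at ht
  exact ht

/-- The level set `{z = 0, a = α, b = β}` has degree `≤ d + 2D`. -/
theorem hasDeg_levelSet {n d D : ℕ} {z a b : (Fin n → Bool) → Bool} (hz : HasDeg z d) (ha : HasDeg a D)
    (hb : HasDeg b D) (α β : Bool) :
    HasDeg (fun v => !z v && (a v == α) && (b v == β)) (d + 2 * D) := by
  have hA : HasDeg (fun v => (a v == α)) D := by
    cases α
    · have e : (fun v => (a v == false)) = fun v => !a v := by funext v; cases a v <;> rfl
      rw [e]; exact hasDeg_not ha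
    · have e : (fun v => (a v == true)) = a := by funext v; cases a v <;> rfl
      rw [e]; exact ha
  have hB : HasDeg (fun v => (b v == β)) D := by
    cases β
    · have e : (fun v => (b v == false)) = fun v => !b v := by funext v; cases b v <;> rfl
      rw [e]; exact hasDeg_not hb
    · have e : (fun v => (b v == true)) = b := by funext v; cases b v <;> rfl
      rw [e]; exact hb
  have h := hasDeg_and (hasDeg_and (hasDeg_not hz) hA) hB
  rw [two_mul, ← add_assoc]
  exact h

/-- **R1' `RelElimPropOfPLDAMS`** (Sketch10 §22.1, verbatim). -/
theorem relElimProp_of_pldamsBool : RelElimPropOfPLDAMS := by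
  intro κ₀ D' hP
  obtain ⟨n₀, hP⟩ := hP
  refine ⟨n₀, fun n hn d D hdD z a b hz ha hb c => ?_⟩
  classical
  -- partition both sides by the stakes `(a v, b v)`
  set Z := (univ.filter fun v : Fin n → Bool => z v = false) with hZ
  set E := (univ.filter fun v : Fin n → Bool => z v = false ∧ elimFail c a b v = true) with hE
  have hZsum : Z.card = ∑ p : Bool × Bool, (Z.filter fun v => (a v, b v) = p).card :=
    Finset.card_eq_sum_card_fiberwise fun v _ => Finset.mem_univ _
  have hEsum : E.card = ∑ p : Bool × Bool, (E.filter fun v => (a v, b v) = p).card :=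
    Finset.card_eq_sum_card_fiberwise fun v _ => Finset.mem_univ _
  have hzeros : zeros z = Z.card := rfl
  rw [hzeros, hZsum, hEsum]
  push_cast
  rw [Finset.mul_sum]
  refine Finset.sum_le_sum fun p _ => ?_
  obtain ⟨α, β⟩ := p
  -- PLDAMS on the level set, at a residue where `(α, β)` fails
  obtain ⟨t, ht⟩ := exists_elimFailBits_true' c α β
  have h := hP n hn (fun v => !z v && (a v == α) && (b v == β))
    (hasDeg_of_le (hasDeg_levelSet hz ha hb α β) hdD) t.val
  have e1 : (univ.filter fun v : Fin n → Bool => (!z v && (a v == α) && (b v == β)) = true) =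
      Z.filter fun v => (a v, b v) = (α, β) := by
    rw [hZ, Finset.filter_filter]
    refine Finset.filter_congr fun v _ => ?_
    simp only [Bool.and_eq_true, Bool.not_eq_true', beq_iff_eq, Prod.mk.injEq, and_assoc]
  have e2 : (univ.filter fun v : Fin n → Bool =>
      (!z v && (a v == α) && (b v == β)) = true ∧ wt v % 3 = t.val % 3) ⊆
      E.filter fun v => (a v, b v) = (α, β) := by
    intro v hv
    rw [Finset.mem_filter] at hv
    obtain ⟨-, h1, h2⟩ := hv
    simp only [Bool.and_eq_true, Bool.not_eq_true', beq_iff_eq] at h1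
    obtain ⟨⟨hzv, hav⟩, hbv⟩ := h1
    rw [hE, Finset.mem_filter, Finset.mem_filter]
    refine ⟨⟨Finset.mem_univ _, hzv, ?_⟩, by rw [hav, hbv]⟩
    unfold elimFail
    rw [hav, hbv, elimFailBits_mod, h2, ← elimFailBits_mod]
    exact ht
  rw [e1] at h
  exact h.trans (by exact_mod_cast Finset.card_le_card e2)

end Summit.QuantumAdvantage.AdviceFreeQNC0

end
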